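import Literature.MathematicalPhysics.QuantumFieldTheory.Balaban1983to89.B5Ineq137Torus
import Literature.MathematicalPhysics.QuantumFieldTheory.GawedzkiKupiainen1985.SubsliceMasslessSize
import HarnessLib

/-!
# Slice legs: Bałaban's own scales `j < k`, summed into the massless-size × scale-`L^k` tails of the three `k = 0` legs

**HONEST FRAMING (page 1 of everything in the β sub-cell of `pub-balaban`).**  Discharging `FlowStep.BetaPertH` would make
Bałaban's ultraviolet stability of 4-d lattice Yang–Mills UNCONDITIONAL — a real constructive-QFT result; it is NOT the
continuum limit and NOT the Clay Millennium problem.  This module is a kernel-checked ASSEMBLY CERTIFICATE for one binder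
of that programme ((W3a)₀ of `Beta.ComposedRoad`, GAPS G-sb12-4′); it asserts nothing about Yang–Mills.

**ABSOLUTE RULE.**  No internally-minted statement may enter as a cited fact.  Every hypothesis below is either
kernel-proved in this package or a verbatim quotation of a PUBLISHED theorem with page reference, carried as a HYPOTHESIS
(`B5Ineq137.Leaf235to237`, the located leaf (2.35)/(2.37) of [B4] Lemma 2.4 read on the whole torus — cell GAPS G-pv07-2 /
G-pv07-5; never cited).  The manuscripts under audit are not citable for their own disputed steps.  Every declaration of
this file is tagged [folklore] (real analysis and finite-matrix algebra) or [cite: …] on DEFINITIONS transcribing a printed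
formula (context, not a fact).

## Context (verbatim, from the certified headers of `B1RG242Torus` / `B5Ineq137` / `SubsliceMasslessSize` and the renders
`1982-cmp85-higgs23-I-p010`, `1983-cmp89-regularity-decay-p012`, `1984-cmp95-propagators-rt-I-p023/p024` read as images by
this lineage)

* [B1] T. Bałaban, *(Higgs)₂,₃ quantum fields in a finite volume I*, Commun. Math. Phys. **85** (1982) 603–636
  [Balaban1982Higgs1], p. 612 (2.42) «G^ε_{k+1} = a_k²(L^kε)^{−4}G^ε_kQ_k^*C^{(k),L^kε}Q_kG^ε_k + G^ε_k», (2.43) the telescoped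
  sum, which «has a fundamental meaning for the analysis of the perturbation expansions» — kernel: `B1RG242Torus.display243`.
* [B4] T. Bałaban, *Regularity and decay of lattice Green's functions*, Commun. Math. Phys. **89** (1983) 571–597
  [Balaban1983RegularityDecay], p. 582 (2.34) «G_k(□) = C^{(0),η}(□) + Σ_{j=1}^{k−1} a_j²(L^jη)^{−4}G_j^η(□)Q_j^*C^{(j),L^jη}(□)Q_jG_j^η(□)»
  and Lemma 2.4: «There exist positive constants c₀, δ₀, … such that |(G_j(□)Q*_j)(x, y)|, |(∂^{L^{−j}}_μG_j(□)Q*_j)(x, y)|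
  ≤ c₀e^{−δ₀|x−y|}, (2.35) … |C^{(j)}(□; y, y′)| ≤ c₀e^{−δ₀|y−y′|}, (2.37)».
* [B5] T. Bałaban, *Propagators and renormalization transformations for lattice gauge theories. I*, Commun. Math. Phys.
  **95** (1984) 17–40 [Balaban1984PropagatorsI], pp. 39–40 (1.135)–(1.137): (2.34) «with □ replaced by the whole torus»,
  each term rescaled to its own unit lattice with the weight L^{−jd} ((1.136)), and «applying the estimates (2.35)–(2.37) of
  Lemma 2.4 in [2]» ((1.137)) — kernel: `B5Display136Torus.entry_eq` (the identity) and `B5Ineq137.kerW_bound` (the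
  per-slice bound |W_j(x,x′)| ≤ (c₀ + ā²c₀³R²)e^{−¾δ′₀L^{k−j}|x−x′|_η}).
* [G–K] K. Gawędzki, A. Kupiainen, *Massless lattice φ⁴₄ theory …*, Commun. Math. Phys. **99** (1985) 197–252
  [GawedzkiKupiainenMasslessLattice1985], p. 207 (2): the accumulated covariance as a geometric sum of rescaled slices —
  kernel SHAPE: `GawedzkiKupiainen1985.Subslice.sum_le_of_slice_bounds_exp` (lit2): `Σ_{l<m}(L₀^l)^{−s}e^{−δr/L₀^l} ≤
  K·min(1,r^{−s})·e^{−(δ/2)r/L₀^m}`, uniformly in `m`.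

## What is proved (0 sorry; nothing cited)

§1 (abstract, over `B5Ineq137.ScaleData`).  `sliceSum_le`: under the hypotheses of `B5Ineq137.kerW_bound` (located leaf,
geometry, row sums at rate ¼δ′₀, |a_j| ≤ ā), for a size exponent `1 ≤ s` and fine points at positive distance,
`|Σ_{j<k} L^{−js}W_j(x,x′)| ≤ C_W·K(L,⅜δ′₀,s)·min(1, r^{−s})·e^{−⅜δ′₀|x−x′|_η}`, `r = L^k|x−x′|_η` = the distance in
fine-lattice units, `C_W = c₀ + ā²c₀³R²`: Bałaban's OWN scales `j < k` ARE the Gawędzki–Kupiainen slices of ratio `L`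
(located reading GAPS C-lit3g7-1: «the levels j < k are the slices; no sub-tower needed»), each massive at its own scale
(`kerW_bound`), and their weighted sum has the MASSLESS SIZE `r^{−s}` AND the overall scale-`L^k` exponential — uniformly
in `k`.  The sum is lit2's lemma, USED (not re-proved).

§2–§3 (concrete: Bałaban's scalar torus tower `B1RG242Torus.tower P a m²`, m² ≥ 0 with m² = 0 allowed, U = 1, on the tori of `Setup`).  For the
cube-free instance `dataM` of `B5Display136Torus.scaleData` (geometry and row sums DISCHARGED by `B5Ineq137Torus`) and two
NEW slice data of the same printed shape — `dataV` (value kernels `K0v, K1v, K3v`: the VALUE clause of (2.35) and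
C^{(0)} itself) and `dataG` (gradient: pv07's derivative leg `K1`, the value leg `K3v`, ∂^1C^{(0)}) — with their entry
identities from (2.43) (`value_entry_eq`: ε^{−2}G^ε_k(x,x′) = Σ_{j<k}L^{−js}Wv_j, d = s+2; `grad_entry_eq`:
ε^{−1}(∂^ε_μG^ε_k)(x,x′) = Σ_{j<k}L^{−js}Wg_j, d = s+1; the mixed one is pv07's `entry_eq`, s = d):
`mixedLeg_le` / `gradLeg_le` / `valueLeg_le` — for `x ≠ x′` at sup torus distance `r` (fine-lattice units),
`|leg_s(x,x′)| ≤ legConst·min(1, r^{−s})·e^{−(⅜δ′₀/L^k)·r}` (s = d, d−1, d−2; at d = 4: 4, 3, 2), given ONLY the located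
leaf for the corresponding data, `0 < a`, `0 ≤ m²` (m² = 0 allowed), `1 ≤ k ≤ m + K + 1`; `legConst` depends on
(c₀, δ′₀, ā, d, L, s) — NOT on k, the volume, the number of steps.  §4: the same in the literal shapes
`R′/r^a·e^{−(δ/n)·r}` and `S′/r^a` (`*_tail`, `*_size`).

## The dictionary to the β road (statement of intent; the identification itself is the (W3b)₀ lane, not this file)

On the fine torus `T^{(0)}` write `n := L^k` and let `P_n := L^{kd}Q_kᵀQ_k` (the block-averaging projection, entries
`n^{−d}·1[same n-block]`) and `Γ_n^{(a_k)} := (−Δ₁ + a_k n^{−2}P_n)^{−1}` (unit lattice spacing).  Since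
`−Δ^ε = ε^{−2}(−Δ₁)` and `a_k(L^kε)^{−2}Q_k^*Q_k = ε^{−2}·a_kn^{−2}P_n` (`Q_k^* = L^{kd}Q_kᵀ`), the tower's
`G^ε_k = (−Δ^ε + a_k(L^kε)^{−2}Q_k^*Q_k)^{−1}` (m² = 0) satisfies `Γ_n = ε^{−2}G^ε_k`, `∇_μΓ_n = ε^{−1}∂^ε_μG^ε_k`,
`∇_μ∇′_νΓ_n = ∂^ε_μG^ε_k∂^{εᵀ}_ν` as matrices on `T^{(0)}` — exactly the three quantities bounded in §2–§4.  With the table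
legs of `Beta.WindowInterface` (freeLeg a = 2, gradLegFwd a = 3, mixedHessLeg a = 4; degrees summing to 6) these are the
shapes of the binders `hFtail : |F′ i n w| ≤ R′ i/(r+1)^{a}·e^{−(δ/n)(r+1)}` and `hGtail : |G′ i n w| ≤ S′ i/(r+1)^{a}` of
`Beta.ComposedRoad.oneLoopDrift_of_composedLegInterfaceOn` at `n = L^k`, FIXED `L`, admissible set `{L^k}`, with
`δ = ⅜δ′₀` and `R′, S′ = legConst` uniform in `k` — i.e. RULING (R10)'s «(S1) exact + (S2) printed class + (S3) lit2,
assembled … with L := n».  NOT done here (other lanes): the identification of the road's `F′, G′` with these kernels and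
of `supNorm w = r+1` with the torus distance ((W3b)₀, an5 lineage `Beta.WindowIdentification`); the window comparison
(W2′)₀ (`Beta.WoodburyFibre`); and above all the located leaf itself — (2.35)/(2.37) on the TORUS uniformly in j at fixed L
(pv23-g4 `TransportLeg` / `FluctuationCovariance`, pv17 `B4Green242Bridge` box kernels at A = 0, lit3 GAPS C-lit3g7-1) —
which enters ONLY as the hypothesis `Leaf235to237 (data• …)`.

## Not claimed

* No constant is computed from the papers: c₀, δ′₀, ā are parameters of the hypothesis; `legConst` is explicit in them.
* The diagonal x = x′ is excluded (the β road never evaluates a leg at w = 0); the `min 1` form covers r < 1 vacuously.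
* The value data read (2.35)'s right leg `K3v` through the symmetry of G_j exactly as `B5Ineq137.Leaf235to237` reads `K3`
  («K3 is the transpose of a (2.35)-kernel, G′_j symmetric»): a reading, recorded in the hypothesis, not proved here.
* Nothing is summit progress.
-/

namespace Literature.MathematicalPhysics.QuantumFieldTheory.Balaban1983to89

open Matrix

noncomputable section

namespace Beta.SliceLegs

open GawedzkiKupiainen1985 (Subslice.slice Subslice.sliceConst Subslice.sum_le_of_slice_bounds_exp)

/-! ## §1 Abstract assembly over `B5Ineq137.ScaleData`: per-slice bound × weight `L^{−js}`, summed by sub-slicing -/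

section Abstract

variable {S : B5.Setting}

/-- The per-slice kernel bound of (1.137) (`B5Ineq137.kerW_bound`: |W_j(x,x′)| ≤ C_W e^{−(3/4)δ′₀ L^{k−j}|x−x′|_η},
C_W = c₀ + ā²c₀³R²) with the weight `L^{−js}`, written as a Gawędzki–Kupiainen SLICE of ratio `L`, size exponent `s`,
rate `¾δ′₀` at the fine-lattice distance `r = L^k|x − x′|_η`: `|L^{−js}W_j(x,x′)| ≤ C_W · slice L (¾δ′₀) s r j`. [folklore] -/
theorem weighted_kerW_le_slice (D : B5Ineq137.ScaleData S) (L c₀ δ₀' cc ā R Λ : ℝ) (d : ℕ) (hL : 1 ≤ L)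
    (hc₀ : 0 ≤ c₀) (hδ : 0 ≤ δ₀') (ha : ∀ j, |D.a j| ≤ ā) (hleaf : B5Ineq137.Leaf235to237 D L c₀ δ₀')
    (G : B5Ineq137.Geometry D L cc) (Rw : B5Ineq137.RowSums D L d (δ₀' / 4) R Λ) (s : ℕ) {j : ℕ}
    (hj : j < S.k) (μ ν : D.Dir) (x x' : D.X) :
    |(L ^ (j * s))⁻¹ * B5Ineq137.kerW D j μ ν x x'|
      ≤ (c₀ + ā ^ 2 * c₀ ^ 3 * R ^ 2) * Subslice.slice L (3 / 4 * δ₀') s (L ^ S.k * D.distX x x') j := by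
  have hL0 : 0 < L := lt_of_lt_of_le one_pos hL
  have hW := B5Ineq137.kerW_bound D L c₀ δ₀' cc ā R Λ d hL hc₀ hδ ha hleaf G Rw hj μ ν x x'
  have e : L ^ (S.k - j) * D.distX x x' = L ^ S.k * D.distX x x' / L ^ j := by
    rw [eq_div_iff (pow_ne_zero _ hL0.ne'), mul_right_comm, ← pow_add, Nat.sub_add_cancel hj.le]
  rw [e] at hW
  have hinv : 0 ≤ ((L ^ j) ^ s)⁻¹ := inv_nonneg.mpr (pow_nonneg (pow_nonneg hL0.le _) _)
  rw [Subslice.slice, pow_mul, abs_mul, abs_inv, abs_of_nonneg (pow_nonneg (pow_nonneg hL0.le _) _)]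
  calc ((L ^ j) ^ s)⁻¹ * |B5Ineq137.kerW D j μ ν x x'|
      ≤ ((L ^ j) ^ s)⁻¹ * ((c₀ + ā ^ 2 * c₀ ^ 3 * R ^ 2) *
          Real.exp (-(3 / 4 * δ₀' * (L ^ S.k * D.distX x x' / L ^ j)))) :=
        mul_le_mul_of_nonneg_left hW hinv
    _ = (c₀ + ā ^ 2 * c₀ ^ 3 * R ^ 2) *
          (((L ^ j) ^ s)⁻¹ * Real.exp (-(3 / 4 * δ₀' * (L ^ S.k * D.distX x x' / L ^ j)))) := by ring

/-- **THE SLICE ASSEMBLY (abstract form).**  Under the hypotheses of `B5Ineq137.kerW_bound` — the located leaf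
(2.35)/(2.37) `Leaf235to237`, the geometry and the row sums at rate `¼δ′₀` — with `1 < L`, `0 < δ′₀` and a size exponent
`1 ≤ s`, for every pair of fine points at POSITIVE distance the weighted slice sum over Bałaban's own scales `j < k` has
MASSLESS SIZE and the overall scale-`L^k` exponential, UNIFORMLY IN `k`:
`|Σ_{j<k} L^{−js} W_j(x,x′)| ≤ C_W · K(L, ⅜δ′₀, s) · min(1, r^{−s}) · e^{−⅜δ′₀ |x−x′|_η}`, `r = L^k|x−x′|_η` the distance in
fine-lattice units (so `e^{−⅜δ′₀|x−x′|_η} = e^{−(⅜δ′₀/L^k)·r}`: decay at the scale `L^k`), `K = Subslice.sliceConst` of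
[`SubsliceMasslessSize`].  The sum is lit2's `Subslice.sum_le_of_slice_bounds_exp`, USED not re-proved. [folklore] -/
theorem sliceSum_le (D : B5Ineq137.ScaleData S) (L c₀ δ₀' cc ā R Λ : ℝ) (d : ℕ) (hL : 1 < L)
    (hc₀ : 0 ≤ c₀) (hδ : 0 < δ₀') (ha : ∀ j, |D.a j| ≤ ā) (hleaf : B5Ineq137.Leaf235to237 D L c₀ δ₀')
    (G : B5Ineq137.Geometry D L cc) (Rw : B5Ineq137.RowSums D L d (δ₀' / 4) R Λ) {s : ℕ} (hs : 1 ≤ s)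
    (μ ν : D.Dir) {x x' : D.X} (hx : 0 < D.distX x x') :
    |∑ j ∈ Finset.range S.k, (L ^ (j * s))⁻¹ * B5Ineq137.kerW D j μ ν x x'|
      ≤ (c₀ + ā ^ 2 * c₀ ^ 3 * R ^ 2) * Subslice.sliceConst L (3 / 8 * δ₀') s
          * min 1 ((L ^ S.k * D.distX x x') ^ s)⁻¹ * Real.exp (-(3 / 8 * δ₀' * D.distX x x')) := by
  have hL0 : 0 < L := lt_trans one_pos hL
  have hr : 0 < L ^ S.k * D.distX x x' := mul_pos (pow_pos hL0 _) hx
  have hC : 0 ≤ c₀ + ā ^ 2 * c₀ ^ 3 * R ^ 2 := by have := Rw.R_nonneg; positivity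
  have hδ' : 0 < 3 / 4 * δ₀' := by positivity
  have h := Subslice.sum_le_of_slice_bounds_exp hL hδ' hr hC hs S.k
    (fun j => (L ^ (j * s))⁻¹ * B5Ineq137.kerW D j μ ν x x')
    (fun j hj => weighted_kerW_le_slice D L c₀ δ₀' cc ā R Λ d hL.le hc₀ hδ.le ha hleaf G Rw s hj μ ν x x')
  have e1 : (3 : ℝ) / 4 * δ₀' / 2 = 3 / 8 * δ₀' := by ring
  have e2 : L ^ S.k * D.distX x x' / L ^ S.k = D.distX x x' := mul_div_cancel_left₀ _ (pow_ne_zero _ hL0.ne')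
  rw [e1, e2] at h
  exact h

/-- The same with the `min` resolved to the pure power (the shape `R′/r^s · e^{−(δ/L^k)·r}` of a beyond-window binder).
[folklore] -/
theorem sliceSum_le_pow (D : B5Ineq137.ScaleData S) (L c₀ δ₀' cc ā R Λ : ℝ) (d : ℕ) (hL : 1 < L)
    (hc₀ : 0 ≤ c₀) (hδ : 0 < δ₀') (ha : ∀ j, |D.a j| ≤ ā) (hleaf : B5Ineq137.Leaf235to237 D L c₀ δ₀')
    (G : B5Ineq137.Geometry D L cc) (Rw : B5Ineq137.RowSums D L d (δ₀' / 4) R Λ) {s : ℕ} (hs : 1 ≤ s)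
    (μ ν : D.Dir) {x x' : D.X} (hx : 0 < D.distX x x') :
    |∑ j ∈ Finset.range S.k, (L ^ (j * s))⁻¹ * B5Ineq137.kerW D j μ ν x x'|
      ≤ (c₀ + ā ^ 2 * c₀ ^ 3 * R ^ 2) * Subslice.sliceConst L (3 / 8 * δ₀') s
          * ((L ^ S.k * D.distX x x') ^ s)⁻¹ * Real.exp (-(3 / 8 * δ₀' * D.distX x x')) := by
  have hL0 : 0 < L := lt_trans one_pos hL
  have hC : 0 ≤ c₀ + ā ^ 2 * c₀ ^ 3 * R ^ 2 := by have := Rw.R_nonneg; positivity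
  have hK : 0 ≤ Subslice.sliceConst L (3 / 8 * δ₀') s := by
    unfold Subslice.sliceConst
    have h1 : (L ^ s)⁻¹ < 1 := by
      rw [inv_lt_one_iff₀]; exact Or.inr (one_lt_pow₀ hL (by omega))
    have h2 : L⁻¹ < 1 := inv_lt_one_of_one_lt₀ hL
    have : 0 < 1 - (L ^ s)⁻¹ := by linarith
    have : 0 < 1 - L⁻¹ := by linarith
    positivity
  refine le_trans (sliceSum_le D L c₀ δ₀' cc ā R Λ d hL hc₀ hδ ha hleaf G Rw hs μ ν hx) ?_
  have hE : 0 ≤ Real.exp (-(3 / 8 * δ₀' * D.distX x x')) := (Real.exp_pos _).le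
  have hm : min 1 ((L ^ S.k * D.distX x x') ^ s)⁻¹ ≤ ((L ^ S.k * D.distX x x') ^ s)⁻¹ := min_le_right _ _
  exact mul_le_mul_of_nonneg_right (mul_le_mul_of_nonneg_left hm (mul_nonneg hC hK)) hE

end Abstract

/-! ## §2 The concrete scalar torus tower: the cube-free `ScaleData` instance and its discharged geometry -/

section Concrete

open B1RG242Torus
open B5Display136Torus (scaleData atLevel atLevel_mk sum_TU TU triple_apply G0unit Grs G_one_eq_smul_G0unit G_eq_smul_Grs)
open B5Ineq137Torus (T distX dXU dUU)

variable (P : Params) (S : B5.Setting)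

/-- The auxiliary data of `B5Ineq137Torus.aux` with the EMPTY cube relation and zero components: the kernels, the
distances and the norms are those of the concrete tower; the cubes Δ̃(y) of (1.137) play no role for POINTWISE kernel
bounds. [folklore] -/
def aux0 : B5Display136Torus.Aux P S := B5Ineq137Torus.aux P S (fun _ _ => False) (fun _ _ _ => 0)

/-- The `ScaleData` of the concrete scalar torus tower at B5-level `S.k` for the MIXED leg ∂^ε_μG^ε_k∂^{εᵀ}_ν
(`B5Display136Torus.scaleData` on `aux0`). [cite: Balaban1984PropagatorsI, (1.135)–(1.136) pp.39–40] -/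
def dataM (a msq : ℝ) : B5Ineq137.ScaleData S := scaleData P S (aux0 P S) a msq

/-- VALUE j = 0 kernel: `K0v x x′ = ε^{−2}·G^ε_1(x,x′) = C^{(0)}-kernel on the unit lattice ε^{−1}T_ε` (`K0v_eq`: the plain
entry of `B5Display136Torus.G0unit`); the directions are dummies. [cite: Balaban1983RegularityDecay, (2.34)/(2.37) p.582] -/
def K0v (a msq : ℝ) (_μ _ν : Fin P.d) (x x' : Site P 0) : ℝ := (P.eps ^ 2)⁻¹ * (tower P a msq).G 1 x x'

/-- VALUE block leg: `K1v j x ⟨j,y⟩ = (L^jε)^{−2}·(G^ε_jQ^*_j)(x,y) = (G_j^{resc}Q^*_j)(x,y)` (`K1v_eq`), the kernel of the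
VALUE clause of (2.35) «|(G_j(□)Q*_j)(x, y)| ≤ c₀e^{−δ₀|x−y|}»; zero off level j. [cite: Balaban1983RegularityDecay, (2.35) p.582] -/
def K1v (a msq : ℝ) (j : ℕ) (_μ : Fin P.d) (x : Site P 0) (u : (i : ℕ) × Site P i) : ℝ :=
  (P.spacing j ^ 2)⁻¹ * atLevel j (fun y => ((tower P a msq).G j * (tower P a msq).Qks j) x y) u

/-- VALUE right leg: `K3v j ⟨j,y′⟩ x′ = (L^jε)^{−2}L^{jd}·(Q_jG^ε_j)(y′,x′) = L^{jd}(Q_jG_j^{resc})(y′,x′)` (`K3v_eq`) — the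
kernel for the weight L^{−jd} of (1.136), = (G_j^{resc}Q^*_j)(x′,y′) by the symmetry of G_j (a (2.35) value kernel);
zero off level j. [cite: Balaban1983RegularityDecay, (2.35) p.582; Balaban1984PropagatorsI, (1.136) p.40] -/
def K3v (a msq : ℝ) (j : ℕ) (_ν : Fin P.d) (u : (i : ℕ) × Site P i) (x' : Site P 0) : ℝ :=
  (P.spacing j ^ 2)⁻¹ * (P.L : ℝ) ^ (j * P.d) *
    atLevel j (fun y => ((tower P a msq).Qk j * (tower P a msq).G j) y x') u

/-- GRADIENT j = 0 kernel: `K0g μ x x′ = ε^{−1}·(∂^ε_μG^ε_1)(x,x′) = (∂^1_μC^{(0)})(x,x′)` on the unit lattice (`K0g_eq`).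
[cite: Balaban1983RegularityDecay, (2.34)/(2.37) p.582] -/
def K0g (a msq : ℝ) (μ _ν : Fin P.d) (x x' : Site P 0) : ℝ :=
  P.eps⁻¹ * (deriv P 0 P.eps μ * (tower P a msq).G 1) x x'

/-- The `ScaleData` of the VALUE leg ε^{−2}G^ε_k(x,x′): `dataM` with the kernels K0v, K1v, (K2), K3v.
[cite: Balaban1984PropagatorsI, (1.135) p.39] -/
def dataV (a msq : ℝ) : B5Ineq137.ScaleData S :=
  { dataM P S a msq with K0 := K0v P a msq, K1 := K1v P a msq, K3 := K3v P a msq }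

/-- The `ScaleData` of the GRADIENT leg ε^{−1}(∂^ε_μG^ε_k)(x,x′): `dataM` with the kernels K0g, (K1 = pv07's derivative
block leg), (K2), K3v. [cite: Balaban1984PropagatorsI, (1.135) p.39] -/
def dataG (a msq : ℝ) : B5Ineq137.ScaleData S :=
  { dataM P S a msq with K0 := K0g P a msq, K3 := K3v P a msq }

variable {P S}

/-- The cube facts hold vacuously for the empty cube relation. [folklore] -/
theorem cubeFacts0 : B5Ineq137Torus.CubeFacts P S (fun _ _ => False) 0 where
  sep := fun _ _ _ _ h _ => h.elim
  near := fun _ _ _ h _ => h.elim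

/-- `Geometry` of `dataM`: DISCHARGED (`B5Ineq137Torus.geometry`). [folklore] -/
theorem geometryM (a msq : ℝ) : B5Ineq137.Geometry (dataM P S a msq) P.L 0 :=
  B5Ineq137Torus.geometry (cubeFacts0 (P := P) (S := S)) a msq

/-- `RowSums` of `dataM` at any rate `κ > 0`: DISCHARGED (`B5Ineq137Torus.rowSums`), levels `S.k ≤ m + K + 1`. [folklore] -/
theorem rowSumsM (hk : S.k ≤ P.m + P.K + 1) {κ : ℝ} (hκ : 0 < κ) (a msq : ℝ) :
    B5Ineq137.RowSums (dataM P S a msq) P.L P.d κ (Real.exp κ * B4Sect5Proof.latticeConst P.d κ)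
      (B5Ineq137Torus.Lam P.d κ) :=
  B5Ineq137Torus.rowSums hk hκ a msq

/-- The located leaf does not see the cubes: `Leaf235to237` for ANY cube/component data of `B5Ineq137Torus.aux` is
literally `Leaf235to237` for `dataM`. [folklore] -/
theorem leaf_iff (cube : Site P 0 → S.Site → Prop) (comp : S.Loc → Fin P.d → (Site P 0 → ℝ)) (a msq c₀ δ₀' : ℝ) :
    B5Ineq137.Leaf235to237 (scaleData P S (B5Ineq137Torus.aux P S cube comp) a msq) P.L c₀ δ₀'
      ↔ B5Ineq137.Leaf235to237 (dataM P S a msq) P.L c₀ δ₀' := Iff.rfl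

/-- The constant of the three leg bounds: `C_W · K(L, ⅜δ′₀, s)` with `C_W = c₀ + ā²c₀³R²`,
`R = e^{¼δ′₀}K_d(¼δ′₀)` the unit-lattice row-sum constant of `B5Ineq137Torus.rowSums`. Depends on (c₀, δ′₀, ā, d, L, s)
only — NOT on the level `k`, the volume `m`, the number of steps `K`. [folklore] -/
def legConst (P : Params) (c₀ δ₀' ā : ℝ) (s : ℕ) : ℝ :=
  (c₀ + ā ^ 2 * c₀ ^ 3 * (Real.exp (δ₀' / 4) * B4Sect5Proof.latticeConst P.d (δ₀' / 4)) ^ 2)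
    * Subslice.sliceConst (P.L : ℝ) (3 / 8 * δ₀') s

/-- Distinct fine points are at positive sup torus distance. [folklore] -/
theorem T_pos_of_ne {x x' : Site P 0} (hx : x ≠ x') : 0 < T P 0 x x' :=
  lt_of_le_of_ne (B5Ineq137Torus.T_nonneg P 0 x x') fun h => hx (B5Ineq137Torus.eq_of_T_eq_zero P h.symm)

/-- `L^k · |x − x′|_η = |x − x′|` in fine-lattice units. [folklore] -/
theorem pow_mul_distX (k : ℕ) (x x' : Site P 0) : (P.L : ℝ) ^ k * distX P k x x' = T P 0 x x' := by
  unfold B5Ineq137Torus.distX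
  rw [mul_inv_cancel_left₀ (pow_ne_zero _ P.cast_L_pos.ne')]

/-- **THE MIXED LEG (s = d).**  For the concrete scalar torus tower at level `1 ≤ k ≤ m + K + 1`, `a > 0`, `m² ≥ 0`
(m² = 0 allowed), given ONLY the located leaf (2.35)/(2.37) at rate δ′₀ with constant c₀ and a bound `|a_j| ≤ ā`:
for fine points `x ≠ x′` at sup torus distance `r = |x − x′|` (fine-lattice units),
`|(∂^ε_μ G^ε_k ∂^{εᵀ}_ν)(x,x′)| ≤ C · min(1, r^{−d}) · e^{−(⅜δ′₀/L^k)·r}`, `C = legConst (s := d)` — massless size `r^{−d}`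
AND decay at the scale `L^k`, uniformly in `k`; entry = Σ_j L^{−jd}W_j by `B5Display136Torus.entry_eq` ((2.43)),
slices by `sliceSum_le`. [folklore] -/
theorem mixedLeg_le {a msq : ℝ} (ha : 0 < a) (hm : 0 ≤ msq) (hk : 1 ≤ S.k) (hkK : S.k ≤ P.m + P.K + 1)
    {c₀ δ₀' ā : ℝ} (hc₀ : 0 ≤ c₀) (hδ : 0 < δ₀') (hā : ∀ j, |B1.aSeq a P.L j| ≤ ā)
    (hleaf : B5Ineq137.Leaf235to237 (dataM P S a msq) P.L c₀ δ₀') (μ ν : Fin P.d) {x x' : Site P 0}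
    (hx : x ≠ x') :
    |(deriv P 0 P.eps μ * (tower P a msq).G S.k * (deriv P 0 P.eps ν)ᵀ) x x'|
      ≤ legConst P c₀ δ₀' ā P.d * min 1 (T P 0 x x' ^ P.d)⁻¹
          * Real.exp (-(3 / 8 * δ₀' / (P.L : ℝ) ^ S.k * T P 0 x x')) := by
  have hdist : 0 < (dataM P S a msq).distX x x' := by
    show 0 < distX P S.k x x'
    unfold B5Ineq137Torus.distX
    exact mul_pos (inv_pos.mpr (pow_pos P.cast_L_pos _)) (T_pos_of_ne hx)
  have h := sliceSum_le (dataM P S a msq) P.L c₀ δ₀' 0 ā _ _ P.d (one_lt_cast_L P) hc₀ hδ hā hleaf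
    (geometryM a msq) (rowSumsM hkK (by positivity : 0 < δ₀' / 4) a msq) P.hd μ ν hdist
  rw [B5Display136Torus.entry_eq P S (aux0 P S) ha hm hk μ ν x x']
  have e1 : ((P.L : ℝ) ^ S.k * (dataM P S a msq).distX x x') = T P 0 x x' := pow_mul_distX S.k x x'
  have e2 : -(3 / 8 * δ₀' * (dataM P S a msq).distX x x') = -(3 / 8 * δ₀' / (P.L : ℝ) ^ S.k * T P 0 x x') := by
    show -(3 / 8 * δ₀' * distX P S.k x x') = _
    unfold B5Ineq137Torus.distX
    ring
  rw [e1, e2] at h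
  simpa only [legConst, dataM] using h

/-! ## §3 The value leg (s = d − 2) and the gradient leg (s = d − 1): slice data of the same printed shape -/

/-! ### Dictionary lemmas: the new kernels ARE the plain entries of the rescaled operators -/

/-- `K0v = G_0^{unit}` entrywise. [cite: Balaban1984PropagatorsI, (1.136) p.40] -/
theorem K0v_eq {a msq : ℝ} (ha : 0 < a) (hm : 0 ≤ msq) (μ ν : Fin P.d) (x x' : Site P 0) :
    K0v P a msq μ ν x x' = G0unit P a msq x x' := by
  rw [K0v, G_one_eq_smul_G0unit ha hm, Matrix.smul_apply, smul_eq_mul, inv_mul_cancel_left₀ (pow_ne_zero _ P.eps_pos.ne')]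

/-- `K1v j x ⟨j,y⟩ = (G_j^{resc}Q^*_j)(x,y)`, 1 ≤ j. [cite: Balaban1983RegularityDecay, (2.35) p.582] -/
theorem K1v_eq {a msq : ℝ} (ha : 0 < a) (hm : 0 ≤ msq) {j : ℕ} (hj : 1 ≤ j) (μ : Fin P.d) (x : Site P 0)
    (y : Site P j) : K1v P a msq j μ x ⟨j, y⟩ = (Grs P a msq j * (tower P a msq).Qks j) x y := by
  have hs : P.spacing j ≠ 0 := (P.spacing_pos j).ne'
  rw [K1v, atLevel_mk, G_eq_smul_Grs ha hm hj]
  simp only [Matrix.smul_mul, Matrix.smul_apply, smul_eq_mul]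
  field_simp

/-- `K3v j ⟨j,y′⟩ x′ = L^{jd}(Q_jG_j^{resc})(y′,x′)`, 1 ≤ j. [cite: Balaban1984PropagatorsI, (1.136) p.40] -/
theorem K3v_eq {a msq : ℝ} (ha : 0 < a) (hm : 0 ≤ msq) {j : ℕ} (hj : 1 ≤ j) (ν : Fin P.d) (y : Site P j)
    (x' : Site P 0) :
    K3v P a msq j ν ⟨j, y⟩ x' = (P.L : ℝ) ^ (j * P.d) * ((tower P a msq).Qk j * Grs P a msq j) y x' := by
  have hs : P.spacing j ≠ 0 := (P.spacing_pos j).ne'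
  rw [K3v, atLevel_mk, G_eq_smul_Grs ha hm hj]
  simp only [Matrix.mul_smul, Matrix.smul_apply, smul_eq_mul]
  field_simp

/-- `∂^ε_μ = ε^{−1}·∂^1_μ`. [folklore] -/
theorem deriv_eps (μ : Fin P.d) : deriv P 0 P.eps μ = P.eps⁻¹ • deriv P 0 1 μ := by
  have h := B5Display136Torus.deriv_rescale P (i := 0) 1 P.eps⁻¹ μ
  rwa [one_div, inv_inv] at h

/-- `K0g μ x x′ = (∂^1_μ G_0^{unit})(x,x′)`. [cite: Balaban1984PropagatorsI, (1.136) p.40] -/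
theorem K0g_eq {a msq : ℝ} (ha : 0 < a) (hm : 0 ≤ msq) (μ ν : Fin P.d) (x x' : Site P 0) :
    K0g P a msq μ ν x x' = (deriv P 0 1 μ * G0unit P a msq) x x' := by
  have hε : P.eps ≠ 0 := P.eps_pos.ne'
  rw [K0g, G_one_eq_smul_G0unit ha hm, deriv_eps, Matrix.smul_mul, Matrix.mul_smul, smul_smul, Matrix.smul_apply,
    smul_eq_mul]
  field_simp

/-! ### The j-th terms with their weights -/

/-- VALUE TERM: `L^{−js}·Wv_j(x,x′) = ε^{−2}·(a_j²(L^jε)^{−4}G^ε_jQ^*_jC^{(j)}Q_jG^ε_j)(x,x′)` for `d = s + 2`, 1 ≤ j — the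
powers of L^jε recombine: (L^jε)^{−6}L^{jd}·L^{−js} = ε^{−2}(L^jε)^{−4}. [cite: Balaban1982Higgs1, (2.43) p.612] -/
theorem value_term_entry (a msq : ℝ) {s : ℕ} (hds : P.d = s + 2) {j : ℕ} (hj : 1 ≤ j) (μ ν : Fin P.d)
    (x x' : Site P 0) :
    ((P.L : ℝ) ^ (j * s))⁻¹ * B5Ineq137.kerW (dataV P S a msq) j μ ν x x'
      = (P.eps ^ 2)⁻¹ * (tower P a msq).term j x x' := by
  have hj0 : j ≠ 0 := by omega
  have hε : P.eps ≠ 0 := P.eps_pos.ne'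
  have hL : (P.L : ℝ) ≠ 0 := P.cast_L_pos.ne'
  rw [B5Ineq137.kerW, if_neg hj0]
  show ((P.L : ℝ) ^ (j * s))⁻¹ * (B1.aSeq a P.L j ^ 2 *
      ∑ u ∈ TU P j, ∑ u' ∈ TU P j, K1v P a msq j μ x u * B5Display136Torus.K2 P a msq j u u' * K3v P a msq j ν u' x') = _
  rw [sum_TU]
  simp_rw [sum_TU]
  simp only [K1v, B5Display136Torus.K2, K3v, atLevel_mk]
  rw [term_eq, Matrix.smul_apply, smul_eq_mul,
    show (tower P a msq).G j * (tower P a msq).Qks j * (tower P a msq).C j * (tower P a msq).Qk j * (tower P a msq).G j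
      = ((tower P a msq).G j * (tower P a msq).Qks j) * (tower P a msq).C j
        * ((tower P a msq).Qk j * (tower P a msq).G j) by simp only [Matrix.mul_assoc],
    triple_apply]
  simp only [Finset.mul_sum]
  refine Finset.sum_congr rfl fun y _ => Finset.sum_congr rfl fun y' _ => ?_
  rw [hds, show P.spacing j = (P.L : ℝ) ^ j * P.eps from rfl]
  field_simp
  ring

/-- GRADIENT TERM: `L^{−js}·Wg_j(x,x′) = ε^{−1}·(∂^ε_μ a_j²(L^jε)^{−4}G^ε_jQ^*_jC^{(j)}Q_jG^ε_j)(x,x′)` for `d = s + 1`, 1 ≤ j.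
[cite: Balaban1982Higgs1, (2.43) p.612] -/
theorem grad_term_entry (a msq : ℝ) {s : ℕ} (hds : P.d = s + 1) {j : ℕ} (hj : 1 ≤ j) (μ ν : Fin P.d)
    (x x' : Site P 0) :
    ((P.L : ℝ) ^ (j * s))⁻¹ * B5Ineq137.kerW (dataG P S a msq) j μ ν x x'
      = P.eps⁻¹ * (deriv P 0 P.eps μ * (tower P a msq).term j) x x' := by
  have hj0 : j ≠ 0 := by omega
  have hε : P.eps ≠ 0 := P.eps_pos.ne'
  have hL : (P.L : ℝ) ≠ 0 := P.cast_L_pos.ne'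
  rw [B5Ineq137.kerW, if_neg hj0]
  show ((P.L : ℝ) ^ (j * s))⁻¹ * (B1.aSeq a P.L j ^ 2 *
      ∑ u ∈ TU P j, ∑ u' ∈ TU P j, B5Display136Torus.K1 P a msq j μ x u * B5Display136Torus.K2 P a msq j u u'
        * K3v P a msq j ν u' x') = _
  rw [sum_TU]
  simp_rw [sum_TU]
  simp only [B5Display136Torus.K1, B5Display136Torus.K2, K3v, atLevel_mk]
  rw [term_eq, Matrix.mul_smul, Matrix.smul_apply, smul_eq_mul,
    show deriv P 0 P.eps μ * ((tower P a msq).G j * (tower P a msq).Qks j * (tower P a msq).C j * (tower P a msq).Qk j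
        * (tower P a msq).G j)
      = (deriv P 0 P.eps μ * (tower P a msq).G j * (tower P a msq).Qks j) * (tower P a msq).C j
        * ((tower P a msq).Qk j * (tower P a msq).G j) by simp only [Matrix.mul_assoc],
    triple_apply]
  simp only [Finset.mul_sum]
  refine Finset.sum_congr rfl fun y _ => Finset.sum_congr rfl fun y' _ => ?_
  rw [hds, show P.spacing j = (P.L : ℝ) ^ j * P.eps from rfl]
  field_simp
  ring

/-! ### The entry identities from (2.43) -/

/-- **VALUE ENTRY IDENTITY**: `ε^{−2}G^ε_k(x,x′) = Σ_{j<k} L^{−js}Wv_j(x,x′)` (`d = s + 2`, 1 ≤ k), from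
`B1RG242Torus.display243`. [cite: Balaban1982Higgs1, (2.43) p.612; Balaban1984PropagatorsI, (1.135) p.39] -/
theorem value_entry_eq {a msq : ℝ} (ha : 0 < a) (hm : 0 ≤ msq) {s : ℕ} (hds : P.d = s + 2) (hk : 1 ≤ S.k)
    (μ ν : Fin P.d) (x x' : Site P 0) :
    (P.eps ^ 2)⁻¹ * (tower P a msq).G S.k x x'
      = ∑ j ∈ Finset.range S.k, ((P.L : ℝ) ^ (j * s))⁻¹ * B5Ineq137.kerW (dataV P S a msq) j μ ν x x' := by
  obtain ⟨k', hk'⟩ : ∃ k', S.k = k' + 1 := ⟨S.k - 1, by omega⟩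
  rw [display243 P ha hm S.k hk, Matrix.add_apply, Matrix.sum_apply, mul_add, Finset.mul_sum, hk',
    Finset.range_eq_Ico, Finset.sum_eq_sum_Ico_succ_bot (Nat.succ_pos k'), add_comm]
  congr 1
  · rw [B5Ineq137.kerW, if_pos rfl, zero_mul, pow_zero, inv_one, one_mul]
    rfl
  · refine Finset.sum_congr rfl fun j hjm => ?_
    exact (value_term_entry a msq hds (Finset.mem_Ico.mp hjm).1 μ ν x x').symm

/-- **GRADIENT ENTRY IDENTITY**: `ε^{−1}(∂^ε_μG^ε_k)(x,x′) = Σ_{j<k} L^{−js}Wg_j(x,x′)` (`d = s + 1`, 1 ≤ k).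
[cite: Balaban1982Higgs1, (2.43) p.612; Balaban1984PropagatorsI, (1.135) p.39] -/
theorem grad_entry_eq {a msq : ℝ} (ha : 0 < a) (hm : 0 ≤ msq) {s : ℕ} (hds : P.d = s + 1) (hk : 1 ≤ S.k)
    (μ ν : Fin P.d) (x x' : Site P 0) :
    P.eps⁻¹ * (deriv P 0 P.eps μ * (tower P a msq).G S.k) x x'
      = ∑ j ∈ Finset.range S.k, ((P.L : ℝ) ^ (j * s))⁻¹ * B5Ineq137.kerW (dataG P S a msq) j μ ν x x' := by
  obtain ⟨k', hk'⟩ : ∃ k', S.k = k' + 1 := ⟨S.k - 1, by omega⟩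
  rw [display243 P ha hm S.k hk, Matrix.mul_add, Matrix.mul_sum, Matrix.add_apply, Matrix.sum_apply, mul_add,
    Finset.mul_sum, hk', Finset.range_eq_Ico, Finset.sum_eq_sum_Ico_succ_bot (Nat.succ_pos k'), add_comm]
  congr 1
  · rw [B5Ineq137.kerW, if_pos rfl, zero_mul, pow_zero, inv_one, one_mul]
    rfl
  · refine Finset.sum_congr rfl fun j hjm => ?_
    exact (grad_term_entry a msq hds (Finset.mem_Ico.mp hjm).1 μ ν x x').symm

/-! ### Geometry and row sums of the two new data (the metric fields are those of `dataM`) -/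

/-- `Geometry` of `dataV`: DISCHARGED (pv07's distance facts; empty cubes). [folklore] -/
theorem geometryV (a msq : ℝ) : B5Ineq137.Geometry (dataV P S a msq) P.L 0 where
  distX_nonneg := fun x x' => B5Ineq137Torus.distX_nonneg P S.k x x'
  dXU_nonneg := fun j x y => B5Ineq137Torus.dXU_nonneg P j x y
  dUU_nonneg := fun j y y' => B5Ineq137Torus.dUU_nonneg P j y y'
  tri := fun _ x x' y₁ y₂ _ hjk => B5Ineq137Torus.tri P hjk.le x x' y₁ y₂
  cube_sep := fun _ _ _ _ h _ => h.elim
  cube_near := fun _ _ _ h _ => h.elim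

/-- `Geometry` of `dataG`: DISCHARGED. [folklore] -/
theorem geometryG (a msq : ℝ) : B5Ineq137.Geometry (dataG P S a msq) P.L 0 where
  distX_nonneg := fun x x' => B5Ineq137Torus.distX_nonneg P S.k x x'
  dXU_nonneg := fun j x y => B5Ineq137Torus.dXU_nonneg P j x y
  dUU_nonneg := fun j y y' => B5Ineq137Torus.dUU_nonneg P j y y'
  tri := fun _ x x' y₁ y₂ _ hjk => B5Ineq137Torus.tri P hjk.le x x' y₁ y₂
  cube_sep := fun _ _ _ _ h _ => h.elim
  cube_near := fun _ _ _ h _ => h.elim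

/-- `RowSums` of `dataV` at any rate κ > 0, levels `S.k ≤ m + K + 1`: DISCHARGED. [folklore] -/
theorem rowSumsV (hk : S.k ≤ P.m + P.K + 1) {κ : ℝ} (hκ : 0 < κ) (a msq : ℝ) :
    B5Ineq137.RowSums (dataV P S a msq) P.L P.d κ (Real.exp κ * B4Sect5Proof.latticeConst P.d κ)
      (B5Ineq137Torus.Lam P.d κ) where
  R_nonneg := mul_nonneg (Real.exp_pos κ).le (B4Sect5Proof.latticeConst_nonneg P.d hκ.le)
  Λ_nonneg := B5Ineq137Torus.Lam_nonneg P.d hκ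
  rowXU := fun j x _ hj => B5Ineq137Torus.rowXU_le P (by omega) hκ x
  rowUU := fun j y _ hj => B5Ineq137Torus.rowUU_le P (by omega) hκ y
  lat := fun j x hj _ => B5Ineq137Torus.lat_le P hj.le hκ x

/-- `RowSums` of `dataG`: DISCHARGED. [folklore] -/
theorem rowSumsG (hk : S.k ≤ P.m + P.K + 1) {κ : ℝ} (hκ : 0 < κ) (a msq : ℝ) :
    B5Ineq137.RowSums (dataG P S a msq) P.L P.d κ (Real.exp κ * B4Sect5Proof.latticeConst P.d κ)
      (B5Ineq137Torus.Lam P.d κ) where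
  R_nonneg := mul_nonneg (Real.exp_pos κ).le (B4Sect5Proof.latticeConst_nonneg P.d hκ.le)
  Λ_nonneg := B5Ineq137Torus.Lam_nonneg P.d hκ
  rowXU := fun j x _ hj => B5Ineq137Torus.rowXU_le P (by omega) hκ x
  rowUU := fun j y _ hj => B5Ineq137Torus.rowUU_le P (by omega) hκ y
  lat := fun j x hj _ => B5Ineq137Torus.lat_le P hj.le hκ x

/-! ### The two leg bounds -/

/-- **THE VALUE LEG (s = d − 2).**  For the concrete scalar torus tower in `d = s + 2` dimensions (d = 4: s = 2), level
`1 ≤ k ≤ m + K + 1`, `a > 0`, `m² ≥ 0`, given ONLY the located VALUE leaf `Leaf235to237 (dataV …)` ((2.35) value clause,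
(2.37), |a_j| ≤ ā): for `x ≠ x′` at sup torus distance r, `|ε^{−2}G^ε_k(x,x′)| ≤ C·min(1, r^{−s})·e^{−(⅜δ′₀/L^k)·r}`,
`C = legConst (s := s)` — the massless size `r^{2−d}` with the scale-`L^k` exponential, uniformly in `k`. [folklore] -/
theorem valueLeg_le {a msq : ℝ} (ha : 0 < a) (hm : 0 ≤ msq) {s : ℕ} (hs : 1 ≤ s) (hds : P.d = s + 2)
    (hk : 1 ≤ S.k) (hkK : S.k ≤ P.m + P.K + 1) {c₀ δ₀' ā : ℝ} (hc₀ : 0 ≤ c₀) (hδ : 0 < δ₀')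
    (hā : ∀ j, |B1.aSeq a P.L j| ≤ ā) (hleaf : B5Ineq137.Leaf235to237 (dataV P S a msq) P.L c₀ δ₀')
    {x x' : Site P 0} (hx : x ≠ x') :
    |(P.eps ^ 2)⁻¹ * (tower P a msq).G S.k x x'|
      ≤ legConst P c₀ δ₀' ā s * min 1 (T P 0 x x' ^ s)⁻¹
          * Real.exp (-(3 / 8 * δ₀' / (P.L : ℝ) ^ S.k * T P 0 x x')) := by
  have hd0 : 0 < P.d := P.hd
  obtain ⟨μ⟩ : Nonempty (Fin P.d) := ⟨⟨0, hd0⟩⟩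
  have hdist : 0 < (dataV P S a msq).distX x x' := by
    show 0 < distX P S.k x x'
    unfold B5Ineq137Torus.distX
    exact mul_pos (inv_pos.mpr (pow_pos P.cast_L_pos _)) (T_pos_of_ne hx)
  have h := sliceSum_le (dataV P S a msq) P.L c₀ δ₀' 0 ā _ _ P.d (one_lt_cast_L P) hc₀ hδ hā hleaf
    (geometryV a msq) (rowSumsV hkK (by positivity : 0 < δ₀' / 4) a msq) hs μ μ hdist
  rw [value_entry_eq ha hm hds hk μ μ x x']
  have e1 : ((P.L : ℝ) ^ S.k * (dataV P S a msq).distX x x') = T P 0 x x' := pow_mul_distX S.k x x'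
  have e2 : -(3 / 8 * δ₀' * (dataV P S a msq).distX x x') = -(3 / 8 * δ₀' / (P.L : ℝ) ^ S.k * T P 0 x x') := by
    show -(3 / 8 * δ₀' * distX P S.k x x') = _
    unfold B5Ineq137Torus.distX
    ring
  rw [e1, e2] at h
  simpa only [legConst] using h

/-- **THE GRADIENT LEG (s = d − 1).**  Same, `d = s + 1` (d = 4: s = 3), located GRADIENT leaf `Leaf235to237 (dataG …)`
((2.35) derivative clause for K1, value clause for K3v, (2.37), ∂^1C^{(0)} at j = 0): for `x ≠ x′`,
`|ε^{−1}(∂^ε_μG^ε_k)(x,x′)| ≤ C·min(1, r^{−s})·e^{−(⅜δ′₀/L^k)·r}`, `C = legConst (s := s)`. [folklore] -/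
theorem gradLeg_le {a msq : ℝ} (ha : 0 < a) (hm : 0 ≤ msq) {s : ℕ} (hs : 1 ≤ s) (hds : P.d = s + 1)
    (hk : 1 ≤ S.k) (hkK : S.k ≤ P.m + P.K + 1) {c₀ δ₀' ā : ℝ} (hc₀ : 0 ≤ c₀) (hδ : 0 < δ₀')
    (hā : ∀ j, |B1.aSeq a P.L j| ≤ ā) (hleaf : B5Ineq137.Leaf235to237 (dataG P S a msq) P.L c₀ δ₀')
    (μ : Fin P.d) {x x' : Site P 0} (hx : x ≠ x') :
    |P.eps⁻¹ * (deriv P 0 P.eps μ * (tower P a msq).G S.k) x x'|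
      ≤ legConst P c₀ δ₀' ā s * min 1 (T P 0 x x' ^ s)⁻¹
          * Real.exp (-(3 / 8 * δ₀' / (P.L : ℝ) ^ S.k * T P 0 x x')) := by
  have hdist : 0 < (dataG P S a msq).distX x x' := by
    show 0 < distX P S.k x x'
    unfold B5Ineq137Torus.distX
    exact mul_pos (inv_pos.mpr (pow_pos P.cast_L_pos _)) (T_pos_of_ne hx)
  have h := sliceSum_le (dataG P S a msq) P.L c₀ δ₀' 0 ā _ _ P.d (one_lt_cast_L P) hc₀ hδ hā hleaf
    (geometryG a msq) (rowSumsG hkK (by positivity : 0 < δ₀' / 4) a msq) hs μ μ hdist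
  rw [grad_entry_eq ha hm hds hk μ μ x x']
  have e1 : ((P.L : ℝ) ^ S.k * (dataG P S a msq).distX x x') = T P 0 x x' := pow_mul_distX S.k x x'
  have e2 : -(3 / 8 * δ₀' * (dataG P S a msq).distX x x') = -(3 / 8 * δ₀' / (P.L : ℝ) ^ S.k * T P 0 x x') := by
    show -(3 / 8 * δ₀' * distX P S.k x x') = _
    unfold B5Ineq137Torus.distX
    ring
  rw [e1, e2] at h
  simpa only [legConst] using h

/-! ## §4 The literal binder shapes: `R′/r^a · e^{−(δ/n)·r}` (hFtail) and `S′/r^a` (hGtail), n = L^k -/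

/-- From the `min`-form to the two binder shapes. [folklore] -/
theorem tail_shapes {A C r c : ℝ} {s : ℕ} (hC : 0 ≤ C) (hr : 0 < r) (hc : 0 ≤ c)
    (h : A ≤ C * min 1 (r ^ s)⁻¹ * Real.exp (-(c * r))) :
    A ≤ C / r ^ s * Real.exp (-c * r) ∧ A ≤ C / r ^ s := by
  have hE : 0 ≤ Real.exp (-(c * r)) := (Real.exp_pos _).le
  have hE1 : Real.exp (-(c * r)) ≤ 1 := Real.exp_le_one_iff.mpr (by nlinarith)
  have hm : min 1 (r ^ s)⁻¹ ≤ (r ^ s)⁻¹ := min_le_right _ _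
  have h1 : A ≤ C / r ^ s * Real.exp (-(c * r)) :=
    le_trans h (by rw [div_eq_mul_inv]; exact mul_le_mul_of_nonneg_right (mul_le_mul_of_nonneg_left hm hC) hE)
  refine ⟨by rwa [neg_mul] , le_trans h1 ?_⟩
  have hCr : 0 ≤ C / r ^ s := div_nonneg hC (pow_nonneg hr.le _)
  calc C / r ^ s * Real.exp (-(c * r)) ≤ C / r ^ s * 1 := mul_le_mul_of_nonneg_left hE1 hCr
    _ = C / r ^ s := mul_one _

/-- `legConst ≥ 0`. [folklore] -/
theorem legConst_nonneg {c₀ δ₀' : ℝ} (hc₀ : 0 ≤ c₀) (hδ : 0 < δ₀') (ā : ℝ) (s : ℕ) :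
    0 ≤ legConst P c₀ δ₀' ā s := by
  unfold legConst
  have h1 := B4Sect5Proof.latticeConst_nonneg P.d (by positivity : (0:ℝ) ≤ δ₀' / 4)
  have h2 := GawedzkiKupiainen1985.Subslice.sliceConst_pos (one_lt_cast_L P) (by positivity : (0:ℝ) < 3 / 8 * δ₀') s
  positivity

/-- **MIXED LEG, hFtail shape** (a = d): `|(∂^ε_μG^ε_k∂^{εᵀ}_ν)(x,x′)| ≤ R′/r^d · e^{−(δ/n)·r}`, `n = L^k`, `δ = ⅜δ′₀`,
`R′ = legConst (s := d)`. [folklore] -/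
theorem mixedLeg_tail {a msq : ℝ} (ha : 0 < a) (hm : 0 ≤ msq) (hk : 1 ≤ S.k) (hkK : S.k ≤ P.m + P.K + 1)
    {c₀ δ₀' ā : ℝ} (hc₀ : 0 ≤ c₀) (hδ : 0 < δ₀') (hā : ∀ j, |B1.aSeq a P.L j| ≤ ā)
    (hleaf : B5Ineq137.Leaf235to237 (dataM P S a msq) P.L c₀ δ₀') (μ ν : Fin P.d) {x x' : Site P 0}
    (hx : x ≠ x') :
    |(deriv P 0 P.eps μ * (tower P a msq).G S.k * (deriv P 0 P.eps ν)ᵀ) x x'|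
      ≤ legConst P c₀ δ₀' ā P.d / T P 0 x x' ^ P.d * Real.exp (-(3 / 8 * δ₀' / (P.L : ℝ) ^ S.k) * T P 0 x x')
    ∧ |(deriv P 0 P.eps μ * (tower P a msq).G S.k * (deriv P 0 P.eps ν)ᵀ) x x'|
      ≤ legConst P c₀ δ₀' ā P.d / T P 0 x x' ^ P.d :=
  tail_shapes (legConst_nonneg hc₀ hδ ā P.d) (T_pos_of_ne hx)
    (div_nonneg (by positivity) (pow_nonneg P.cast_L_pos.le _))
    (mixedLeg_le ha hm hk hkK hc₀ hδ hā hleaf μ ν hx)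

/-- **VALUE LEG, hFtail / hGtail shapes** (a = s = d − 2). [folklore] -/
theorem valueLeg_tail {a msq : ℝ} (ha : 0 < a) (hm : 0 ≤ msq) {s : ℕ} (hs : 1 ≤ s) (hds : P.d = s + 2)
    (hk : 1 ≤ S.k) (hkK : S.k ≤ P.m + P.K + 1) {c₀ δ₀' ā : ℝ} (hc₀ : 0 ≤ c₀) (hδ : 0 < δ₀')
    (hā : ∀ j, |B1.aSeq a P.L j| ≤ ā) (hleaf : B5Ineq137.Leaf235to237 (dataV P S a msq) P.L c₀ δ₀')
    {x x' : Site P 0} (hx : x ≠ x') :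
    |(P.eps ^ 2)⁻¹ * (tower P a msq).G S.k x x'|
      ≤ legConst P c₀ δ₀' ā s / T P 0 x x' ^ s * Real.exp (-(3 / 8 * δ₀' / (P.L : ℝ) ^ S.k) * T P 0 x x')
    ∧ |(P.eps ^ 2)⁻¹ * (tower P a msq).G S.k x x'| ≤ legConst P c₀ δ₀' ā s / T P 0 x x' ^ s :=
  tail_shapes (legConst_nonneg hc₀ hδ ā s) (T_pos_of_ne hx)
    (div_nonneg (by positivity) (pow_nonneg P.cast_L_pos.le _))
    (valueLeg_le ha hm hs hds hk hkK hc₀ hδ hā hleaf hx)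

/-- **GRADIENT LEG, hFtail / hGtail shapes** (a = s = d − 1). [folklore] -/
theorem gradLeg_tail {a msq : ℝ} (ha : 0 < a) (hm : 0 ≤ msq) {s : ℕ} (hs : 1 ≤ s) (hds : P.d = s + 1)
    (hk : 1 ≤ S.k) (hkK : S.k ≤ P.m + P.K + 1) {c₀ δ₀' ā : ℝ} (hc₀ : 0 ≤ c₀) (hδ : 0 < δ₀')
    (hā : ∀ j, |B1.aSeq a P.L j| ≤ ā) (hleaf : B5Ineq137.Leaf235to237 (dataG P S a msq) P.L c₀ δ₀')
    (μ : Fin P.d) {x x' : Site P 0} (hx : x ≠ x') :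
    |P.eps⁻¹ * (deriv P 0 P.eps μ * (tower P a msq).G S.k) x x'|
      ≤ legConst P c₀ δ₀' ā s / T P 0 x x' ^ s * Real.exp (-(3 / 8 * δ₀' / (P.L : ℝ) ^ S.k) * T P 0 x x')
    ∧ |P.eps⁻¹ * (deriv P 0 P.eps μ * (tower P a msq).G S.k) x x'| ≤ legConst P c₀ δ₀' ā s / T P 0 x x' ^ s :=
  tail_shapes (legConst_nonneg hc₀ hδ ā s) (T_pos_of_ne hx)
    (div_nonneg (by positivity) (pow_nonneg P.cast_L_pos.le _))
    (gradLeg_le ha hm hs hds hk hkK hc₀ hδ hā hleaf μ hx)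

end Concrete

end Beta.SliceLegs

end

end Literature.MathematicalPhysics.QuantumFieldTheory.Balaban1983to89
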